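import Literature.NumberTheory.Automorphic.SymCoeffLattice
import Literature.NumberTheory.Automorphic.PadicEmbeddingCoefficientRingComplete
import Literature.NumberTheory.Automorphic.LevelActionCohomologyFinite
import Literature.NumberTheory.Automorphic.BianchiWeightModule
import HarnessLib

/-!
# Finiteness of `H^i(U, ⨂_τ Sym^{k−2})` for lattice and torsion coefficients (given Borel–Serre)

Topic `NumberTheory/Automorphic`; namespace `Literature.NumberTheory.Automorphic.ParallelWeight`;
instances and theorems.  The `[Finite]` / `Module.Finite` hypotheses of the Hida-theory files for
the coefficient modules `⨂_τ Sym^{k−2}` of `Res_{F/ℚ} GL₂`, discharged GIVEN the named fact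
`BorelSerre1973_finite_groupCohomology_congruenceSubgroup` (`LevelActionCohomologyFinite`):

* `SymCoeffLattice O E F k` is finite free over `O` (`latticeBasis`), finite for finite `O`
  (`finite_symCoeffLattice`); `SymPowTensor S J m` is finite for finite `S`
  (`finite_symPowTensor`);
* `finite_latticeCohomology_of_borelSerre` — `H^i(U, ⨂_τ Sym^{k−2}(S²))` is finite for finite `S`
  and `U` compact open;
* **`moduleFinite_latticeCohomology_of_borelSerre`** — for the coefficient ring
  `𝒪 = padicEmbInt F p ⊆ ℚ_p(τ(F) : τ)` (`PadicEmbeddingCoefficientRing`), `H^i(U, ⨂_τ Sym^{k−2}(𝒪²))`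
  is a finitely generated `𝒪`-module: `𝒪` and the lattice are `p`-adically complete
  (`PadicEmbeddingCoefficientRingComplete`), the lattice is `p`-torsion-free and its reduction
  `⨂_τ Sym^{k−2}((𝒪/p)²)` (`latticeQuotEquiv`) is finite ([Hida1994AIF, §2]; [KhareThorne2017, §6.3]).

## References

* A. Borel, J.-P. Serre, Comment. Math. Helv. 48 (1973), §11.1. [BorelSerre1973]
* H. Hida, Ann. Inst. Fourier 44 (1994), §2 (held). [Hida1994AIF]
* C. Khare, J. A. Thorne, Amer. J. Math. 139 (2017), §6.3 (arXiv:1409.7007, held). [KhareThorne2017]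
-/

noncomputable section

open CategoryTheory IsDedekindDomain NumberField
open scoped Pointwise TensorProduct

namespace Literature.NumberTheory.Automorphic

/-- The exponents of a fixed degree in two variables form a finite set (`d ↦ (d₀, d₁)`,
`dᵢ ≤ m`). [folklore] -/
instance finite_exponents (m : ℕ) : Finite (IntegralWeightGL2.Exponents m) := by
  refine Finite.of_injective
    (fun d : IntegralWeightGL2.Exponents m => fun i : Fin 2 =>
      (⟨d.1 i, Nat.lt_succ_of_le ((Finsupp.le_degree i d.1).trans_eq d.2)⟩ : Fin (m + 1))) ?_
  intro d d' hdd'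
  refine Subtype.ext (Finsupp.ext fun i => ?_)
  have h := congr_fun hdd' i
  simp only [Fin.mk.injEq] at h
  exact h

/-- `⨂_j Sym^{m_j}(S²)` (the tree's `SymPowTensor`) is finite for a finite coefficient ring and
finitely many factors. [folklore] -/
theorem finite_symPowTensor (S : Type) [CommRing S] [Finite S] (J : Type) [Finite J] (m : J → ℕ) :
    Finite (SymPowTensor S J m) := by
  haveI : Module.Finite S (SymPowTensor S J m) :=
    Module.Finite.of_basis (show Module.Basis (∀ j : J, IntegralWeightGL2.Exponents (m j)) S
      (⨂[S] j : J, IntegralWeightGL2.SymPow S (m j)) from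
        Basis.piTensorProduct fun j => IntegralWeightGL2.symPowBasis S (m j))
  exact Module.finite_of_finite S

namespace ParallelWeight

open BigHeckeGLn IntegralWeightGL2 LevelAction

variable (O : Type) [CommRing O] (E : Type) [Field E] [CharZero E] (F : Type) [Field F] [NumberField F]
  (k : ℕ)

/-- The `𝒪`-form is free (tensor monomial basis). [folklore] -/
instance free_symCoeffLattice : Module.Free O (SymCoeffLattice O E F k) :=
  Module.Free.of_basis (latticeBasis O E F k)

/-- The `𝒪`-form is finitely generated. [folklore] -/
instance moduleFinite_symCoeffLattice : Module.Finite O (SymCoeffLattice O E F k) :=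
  Module.Finite.of_basis (latticeBasis O E F k)

/-- The `S`-form is finite for a finite coefficient ring `S`. [folklore] -/
instance finite_symCoeffLattice [Finite O] : Finite (SymCoeffLattice O E F k) :=
  Module.finite_of_finite O

/-- **`H^i(U, ⨂_τ Sym^{k−2}(S²))` is finite** for `S` finite and `U` compact open, GIVEN
`BorelSerre1973_finite_groupCohomology_congruenceSubgroup`. [cite: BorelSerre1973, §11.1]
[cite: KhareThorne2017, §6.3] -/
theorem finite_latticeCohomology_of_borelSerre [Finite O]
    (h : BorelSerre1973_finite_groupCohomology_congruenceSubgroup)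
    (v : (F →+* E) → HeightOneSpectrum (𝓞 F)) (φO : ∀ τ : F →+* E, (v τ).adicCompletionIntegers F →+* O)
    (U : Subgroup (FiniteAdelicGL 2 F)) (hUo : IsOpen (U : Set (FiniteAdelicGL 2 F)))
    (hUc : IsCompact (U : Set (FiniteAdelicGL 2 F))) (hU : U.toSubmonoid ≤ integralMonoid F v) (i : ℕ) :
    Finite (LevelAction.cohomology (globalEmbedding 2 F) (integralMonoid F v) (symLatticeAction O E F k v φO) U i) :=
  LevelAction.finite_cohomology_two_of_borelSerre h F U hUo hUc _ hU _ i

/-! ### Lattice coefficients over `𝒪 = padicEmbInt F p` -/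

section Padic

variable (p : ℕ) [Fact p.Prime]

/-- `p ≠ 0` in `𝒪`. [folklore] -/
theorem natCast_prime_padicEmbInt_ne_zero : ((p : ℕ) : padicEmbInt F p) ≠ 0 := by
  intro h
  have h' : ((p : ℕ) : padicEmbField F p) = 0 := by exact_mod_cast congrArg ((↑) : padicEmbInt F p → padicEmbField F p) h
  exact (norm_pos_iff.1 (norm_natCast_prime_padicEmbField_pos F p)) h'

/-- `𝒪/p` is finite. [folklore] -/
instance finite_padicEmbInt_mod_prime :
    Finite (padicEmbInt F p ⧸ Ideal.span {((p : ℕ) : padicEmbInt F p)}) :=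
  Finite.of_equiv _ (Ideal.quotEquivOfEq (by rw [pow_one]) :
    padicEmbIntMod F p 1 ≃+* padicEmbInt F p ⧸ Ideal.span {((p : ℕ) : padicEmbInt F p)}).toEquiv

/-- **The reduction mod `p` of the `𝒪`-lattice is finite.** [folklore] -/
theorem finite_symCoeffLattice_quotient (k : ℕ) :
    Finite (SymCoeffLattice (padicEmbInt F p) (PadicAlgCl p) F k ⧸
      (((p : ℕ) : padicEmbInt F p) • (⊤ : Submodule (padicEmbInt F p)
        (SymCoeffLattice (padicEmbInt F p) (PadicAlgCl p) F k)))) := by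
  rw [← Submodule.ideal_span_singleton_smul]
  exact Finite.of_equiv _ (latticeQuotEquiv (padicEmbInt F p) (PadicAlgCl p) F k
    (Ideal.span {((p : ℕ) : padicEmbInt F p)})).toEquiv.symm

/-- **`H^i(U, ⨂_τ Sym^{k−2}(𝒪²))` is a finitely generated `𝒪`-module** for `𝒪 = padicEmbInt F p`,
`U` compact open in the integral monoid of the chosen `p`-adic places, GIVEN
`BorelSerre1973_finite_groupCohomology_congruenceSubgroup` (adic Nakayama on cochains: `𝒪` and the
lattice are `p`-adically complete, the lattice is `p`-torsion-free with finite reduction).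
[cite: Hida1994AIF, §2] [cite: KhareThorne2017, §6.3] -/
theorem moduleFinite_latticeCohomology_of_borelSerre
    (h : BorelSerre1973_finite_groupCohomology_congruenceSubgroup)
    (U : Subgroup (FiniteAdelicGL 2 F)) (hUo : IsOpen (U : Set (FiniteAdelicGL 2 F)))
    (hUc : IsCompact (U : Set (FiniteAdelicGL 2 F)))
    (hU : U.toSubmonoid ≤ integralMonoid F (padicPlace F p)) (i : ℕ) :
    Module.Finite (padicEmbInt F p)
      (LevelAction.cohomology (globalEmbedding 2 F) (integralMonoid F (padicPlace F p))
        (symLatticeAction (padicEmbInt F p) (PadicAlgCl p) F k (padicPlace F p) (padicEmbIntHom F p)) U i) := by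
  haveI : IsAdicComplete (Ideal.span {((p : ℕ) : padicEmbInt F p)})
      (SymCoeffLattice (padicEmbInt F p) (PadicAlgCl p) F k) :=
    isAdicComplete_of_free_finite_padicEmbInt F p _
  refine moduleFinite_cohomology_two_of_borelSerre h F ((p : ℕ) : padicEmbInt F p) U hUo hUc _ hU
    (fun x hx => (smul_eq_zero_iff_right (natCast_prime_padicEmbInt_ne_zero F p)).1 hx)
    (finite_symCoeffLattice_quotient F p k) _ i

end Padic

end ParallelWeight

end Literature.NumberTheory.Automorphic
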